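import Mathlib

/-!
# stub-ideation k3 g49 — «decomposition»: THE PARITY DIGIT OF ROAD δ, PER GENUS CLASS ε (ask (t′)(1))

Crux `PrintCf2.SplitBadTwoLowerHalfOfFacts` (stmt-BirchSwinnertonDyer-27851), STUB `stub_heegnerIndexLowerAtTwo`
(LOWER half of BSD₂ over Heegner frames for the additive-at-2 members of the `49a1^{(d)}` class).
FALLBACK 2 = road δ through the good-ordinary twin `A′ = W ⊗ χ_ε`, `ε ∈ {−1, 2, −2}` (rows 133/135/136).

This file is the ℤ-VALUATION SHADOW of the transport step «`(F) ⊆ (L)` on the `χ̃_ε`-branch ⟹ the stub's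
inequality» split into three sub-stubs — ALGEBRAIC specialisation shape, VALUE shape, BRANCH equality modulo
the `μ`-normalisation — with the glue PROVED (omega / decide), and the two digits the split exposes:
(1) the PARITY digit (ask (t′)(1)): consistent on all three classes; the «odd for ε = ±2» reading of the
undescended exponent `n(ε)` is the half-integrality of `v₂ log_{ω_{A′}} z_ε` on the `θ`-eigenspace;
(2) the MAGNITUDE OFFSET digit: the transport reaches the stub iff `i_z ≥ i + 1` (twin genus point one
factor `2` deeper than `y_K`), predicted `i_z − i = 1 + m/2` under exactness.
Nothing here proves BSD, the crux, the stub, (Rδ-1′)₂, (Rδ-2)₂ or (Rδ-3′); every `…Shape` is a receptacle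
`Prop` whose supplier is named in its docstring; weight (B80): all items `w = 0` except the consumed
value shape (the research formula (Rδ-2)₂, `w = 2`, NOT claimed).
-/

namespace Summit.BirchSwinnertonDyer.BirchSwinnertonDyer.Cruxes.SplitBadTwoLowerHalfOfFacts.ParityDigitK3G49

/-! ## §0 The three genus classes `k : Fin 3 ↔ ε = d* ∈ {−1, 2, −2}` (OF RECORD: k2-g45/k2-g46; not re-booked) -/

/-- `d* = ε`, the twisting discriminant of the class (record: `evenGenusDisc`). -/
def dStar : Fin 3 → ℤ := ![-1, 2, -2]

/-- Conductor exponent `n(ε)` of `χ̃_ε` at each prime above `2` (record: `evenGenusExp`, k2-g45 `…_conductorExp_sharp`). -/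
def nExp : Fin 3 → ℕ := ![2, 3, 3]

/-- `v₂(d*)`: the valuation of `θ² = d*`, i.e. twice the valuation of `θ` in `ℚ₂(θ)`. -/
def vDisc : Fin 3 → ℕ := ![0, 1, 1]

/-- `vDisc k` IS the exact `2`-adic valuation of `dStar k`. -/
theorem vDisc_exact (k : Fin 3) : (2 : ℤ) ^ vDisc k ∣ dStar k ∧ ¬ (2 : ℤ) ^ (vDisc k + 1) ∣ dStar k := by
  fin_cases k <;> simp [vDisc, dStar]

/-- The digit that dissolves «even for `ε = −1`, odd for `ε = ±2`»: `n(ε) ≡ v₂(d*) (mod 2)` on all three classes. -/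
theorem nExp_sub_vDisc (k : Fin 3) : nExp k = vDisc k + 2 := by
  fin_cases k <;> rfl

/-! ## §1 Sub-stub H (half-integrality on the `θ`-eigenspace) — `w = 0`

`z_ε` lies in the `χ̃_ε`-eigenspace of `A′(K(θ))`, `θ² = d*`; `log_{ω_{A′}}` is Galois-equivariant into
`ℚ₂(θ)` (`𝔭` split: `K_𝔭 = ℚ₂`), so `log_{ω_{A′}} z_ε ∈ θ·ℚ₂` and, through the twisting isomorphism,
`log_{ω_{A′}} z_ε = θ · log_{ω_W} z_W` with `z_W ∈ W(K)` (record k2-g46 `descended_cofactor`: «multiplies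
`log²` by `θ² = d*`»). In valuations, with `X2 := 2·v₂ log_{ω_{A′}} z_ε ∈ ℤ` and `xW := v₂ log_{ω_W} z_W ∈ ℤ`: -/
def ThetaEigenLogShape (k : Fin 3) (X2 xW : ℤ) : Prop := X2 = 2 * xW + vDisc k

/-- `v₂ log_{ω_{A′}} z_ε` is a HALF-integer exactly on the classes `ε = ±2`. -/
theorem X2_odd_iff (k : Fin 3) {X2 xW : ℤ} (h : ThetaEigenLogShape k X2 xW) :
    Odd X2 ↔ (k = 1 ∨ k = 2) := by
  fin_cases k <;> simp [ThetaEigenLogShape, vDisc] at h <;> simp [h, Int.odd_iff]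

/-- PARITY DIGIT, value side, undescended normalisation: `v₂ L(χ̃_ε) = 2x_ε − n(ε) = X2 − n(ε)` is EVEN on
every class (NOT odd for `ε = ±2`). -/
theorem undescended_exponent_even (k : Fin 3) {X2 xW : ℤ} (h : ThetaEigenLogShape k X2 xW) :
    Even (X2 - nExp k) := by
  rw [even_iff_two_dvd]
  fin_cases k <;> simp [ThetaEigenLogShape, vDisc, nExp] at h ⊢ <;> omega

/-- … and equals the descended exponent `2·xW − 2` uniformly (k2-g46's `+2^{−2}`, re-derived in valuations). -/
theorem undescended_eq_descended (k : Fin 3) {X2 xW : ℤ} (h : ThetaEigenLogShape k X2 xW) :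
    X2 - nExp k = 2 * xW - 2 := by
  fin_cases k <;> simp [ThetaEigenLogShape, vDisc, nExp] at h ⊢ <;> omega

/-! ## §2 Sub-stub A (algebraic specialisation shape) — `w = 0`

Branch twisting (`e_{χ̃_ε}·X(A′/K[2^∞])` at `T = 0` = `X^{(∅,0)}(W/K_∞^{ac})` at `T = 0`, every class) and
the control theorem of record (LEAD-VERDICT cf2p1-g6 §1: defect `δ = 0` for `W` additive at `2`, modulo the
receptacles (Fin_glob), (Fin_loc), PT(K), PT₂(K)) give
`a := v₂ F^{χ̃_ε}(0) = s + 2g + τK + δ`, `s = v₂ #Ш(W/K)[2^∞]`, `g = v₂ log_ω P_gen`, `τK = v₂ ∏_w c_w(W/K)`. -/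
def AlgSpecShape (a s g τK δ : ℤ) : Prop := a = s + 2 * g + τK + δ

/-- Parity of the algebraic side: EVEN — `s` even (Cassels–Tate, `Finite Ш` is a frame binder), `τK = 2·τQ`
(every prime of `N_W` splits in the Heegner field, the two primes above `2` included: `c_w = c_{w̄} = c_ℓ`),
`δ = 0` (g6 §1). -/
theorem alg_even {a s g τK δ τQ : ℤ} (hA : AlgSpecShape a s g τK δ) (hCT : Even s) (hTam : τK = 2 * τQ)
    (hδ : δ = 0) : Even a := by
  subst hA hTam hδ
  obtain ⟨r, hr⟩ := hCT
  exact ⟨r + g + τQ, by omega⟩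

/-! ## §3 Sub-stub V (value shape at the genus point) — the CONSUMED research formula (Rδ-2)₂, `w = 2`

`vf := v₂ L_frame(χ̃_ε) = 2·x_z − 2·v₂ c + κ`, `x_z = v₂ log_{ω_W} z_W = g + i_z` (`i_z` = `2`-adic index
digit of the transported genus point in `W(K)`), `κ` = the valuation of the frame's constant at the genus
point: road δ (k2-g46, descended) `κ = −2`; v7's frame for `f_W` (g6 §4, `‖u‖₂ = ½`) `κ = +1`. -/
def ValShape (vf g iz c κ : ℤ) : Prop := vf = 2 * (g + iz) - 2 * c + κ

theorem val_even_iff {vf g iz c κ : ℤ} (hV : ValShape vf g iz c κ) : Even vf ↔ Even κ := by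
  subst hV
  simp [Int.even_sub, Int.even_add]

/-! ## §4 Sub-stub B (branch equality modulo the `μ`-normalisation) — consumed from R229's cut, `w = XL`

`L_frame = 2^μ · L_prim` (`μ(L_prim) = 0`); R229 (S1 ∧ S3a ∧ S4≤) gives `(F) = (L_prim)` on the branch,
hence at the genus point `a = vf − μ`; the cut's S2 «`μ(L) = 0`» is the assertion `μ = 0` FOR THE FRAME'S `L`. -/
def BranchEqModMu (a vf : ℤ) (μ : ℕ) : Prop := a + μ = vf

/-- THE PARITY DIGIT (glue, proved): on a branch where A, V, B hold, `μ ≡ κ (mod 2)`. -/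
theorem mu_parity {a s g τK δ τQ vf iz c κ : ℤ} {μ : ℕ} (hA : AlgSpecShape a s g τK δ) (hCT : Even s)
    (hTam : τK = 2 * τQ) (hδ : δ = 0) (hV : ValShape vf g iz c κ) (hB : BranchEqModMu a vf μ) :
    Even (μ : ℤ) ↔ Even κ := by
  have ha := alg_even hA hCT hTam hδ
  have hv := val_even_iff hV
  unfold BranchEqModMu at hB
  constructor
  · intro hμ; exact hv.1 (hB ▸ ha.add hμ)
  · intro hκ
    have hvf := hv.2 hκ
    have : (μ : ℤ) = vf - a := by omega
    rw [this]; exact hvf.sub ha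

/-- Road δ (descended cofactor `2^{−2}`, `κ = −2`) PASSES the parity digit on every class: `μ` is even, so
R229's S2 `μ = 0` is parity-admissible — v7's death does NOT transport. -/
theorem roadDelta_mu_even {a s g τK δ τQ vf iz c : ℤ} {μ : ℕ} (hA : AlgSpecShape a s g τK δ) (hCT : Even s)
    (hTam : τK = 2 * τQ) (hδ : δ = 0) (hV : ValShape vf g iz c (-2)) (hB : BranchEqModMu a vf μ) :
    Even (μ : ℤ) :=
  (mu_parity hA hCT hTam hδ hV hB).2 (by decide)

/-- v7's frame (`κ = +1`, g6 §4 `‖u‖₂ = ½`) FORCES `μ` odd, in particular `μ ≠ 0`: the located factor `2`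
(«true function = 2·integral», v8 road B) — the same glue, other digit. -/
theorem vSeven_mu_odd {a s g τK δ τQ vf iz c : ℤ} {μ : ℕ} (hA : AlgSpecShape a s g τK δ) (hCT : Even s)
    (hTam : τK = 2 * τQ) (hδ : δ = 0) (hV : ValShape vf g iz c 1) (hB : BranchEqModMu a vf μ) :
    μ ≠ 0 := by
  intro h0
  have := (mu_parity hA hCT hTam hδ hV hB).1 (by simp [h0])
  exact (by decide : ¬ Even (1 : ℤ)) this

/-! ## §5 The MAGNITUDE OFFSET digit (what the split exposes beyond parity) — glue proved

With the INCLUSION `(F) ⊆ (L_prim)` only (`a ≥ vf − μ`), the stub's inequality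
`2·i − 2·c ≤ s + τK` (`i = v₂ [W(K) : ℤ·y_K]`) follows iff the offset `2(i_z − i) + κ − μ − δ ≥ 0`. -/
theorem stub_of_transport {a s g τK δ vf iz c κ i : ℤ} {μ : ℕ} (hA : AlgSpecShape a s g τK δ)
    (hV : ValShape vf g iz c κ) (hincl : vf - μ ≤ a) (hoff : 0 ≤ 2 * (iz - i) + κ - μ - δ) :
    2 * i - 2 * c ≤ s + τK := by
  unfold AlgSpecShape at hA; unfold ValShape at hV; omega

/-- The offset hypothesis is NECESSARY: shapes + inclusion hold, offset `< 0`, stub false. -/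
theorem offset_necessary : ∃ a s g τK δ vf iz c κ i : ℤ, ∃ μ : ℕ, AlgSpecShape a s g τK δ ∧
    ValShape vf g iz c κ ∧ vf - μ ≤ a ∧ 2 * (iz - i) + κ - μ - δ < 0 ∧ ¬ 2 * i - 2 * c ≤ s + τK :=
  ⟨0, 0, 0, 0, 0, 0, 1, 0, -2, 1, 0, by norm_num [AlgSpecShape, ValShape]⟩

/-- Road δ's digits (`κ = −2`, `μ = 0`, `δ = 0`): the transport reaches the stub iff `i_z ≥ i + 1`. -/
theorem roadDelta_offset_iff (iz i : ℤ) : 0 ≤ 2 * (iz - i) + (-2) - (0 : ℕ) - 0 ↔ i + 1 ≤ iz := by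
  push_cast; omega

/-- PREDICTION under exactness (equality on the branch AND the exact `x`-law `s + τK = 2i − 2c + m`, `m` the
torsion/Manin/`u_K` digits of the `K`-frame): `2(i_z − i) = m + δ + μ − κ`; for road δ `i_z − i = 1 + m/2`
(three kit numbers for the anchor member: `i`, `i_z`, `m` — ask (r″)-shape). -/
theorem offset_predicted {a s g τK δ vf iz c κ i m : ℤ} {μ : ℕ} (hA : AlgSpecShape a s g τK δ)
    (hV : ValShape vf g iz c κ) (hB : BranchEqModMu a vf μ) (hX : s + τK = 2 * i - 2 * c + m) :
    2 * (iz - i) = m + δ + μ - κ := by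
  unfold AlgSpecShape at hA; unfold ValShape at hV; unfold BranchEqModMu at hB; omega

theorem roadDelta_offset_predicted {a s g τK vf iz c i m : ℤ} (hA : AlgSpecShape a s g τK 0)
    (hV : ValShape vf g iz c (-2)) (hB : BranchEqModMu a vf 0) (hX : s + τK = 2 * i - 2 * c + m) :
    2 * (iz - i) = m + 2 :=
  by have := offset_predicted hA hV hB hX; push_cast at this; omega

/-! ## §6 Plus-branch corroboration at the TRIVIAL character (Castella 2018 Thm 3.2 shape,
[corpus:paper:arxiv-1704.06608 p0009 L96–104]: `L_p(f,𝟙) = (1 − a_p p⁻¹ + ε_p)²·(log_{ω_E} P_K)²` up to a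
`p`-adic unit, `p` odd, `ε_p = p⁻¹` for `p ∤ N`). For the twin at `p = 2` (`a₂(A′) = ±1`) the factor is
`((3 − a₂)/2)² ∈ {1, 4}`: EVEN valuation as well — shape-level only (the formula is UNPRINTED at `p = 2`). -/
theorem trivialChar_factor_even (a2 : ℤ) (h : a2 = 1 ∨ a2 = -1) :
    (3 - a2) ^ 2 = 4 * 1 ∨ (3 - a2) ^ 2 = 4 * 4 := by
  rcases h with rfl | rfl <;> decide

/-! ## §7 Consistency witness (B82: no unsatisfiable-hypothesis glue) and the assembled statement -/

theorem shapes_consistent : ∃ a s g τK δ τQ vf iz c i : ℤ, ∃ μ : ℕ, AlgSpecShape a s g τK δ ∧ Even s ∧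
    τK = 2 * τQ ∧ δ = 0 ∧ ValShape vf g iz c (-2) ∧ BranchEqModMu a vf μ ∧ μ = 0 ∧ i + 1 ≤ iz ∧
    2 * i - 2 * c ≤ s + τK :=
  ⟨2, 0, 0, 2, 0, 1, 2, 2, 0, 1, 0, by norm_num [AlgSpecShape, ValShape, BranchEqModMu]⟩

/-- ASSEMBLED (t′)(1) VERDICT in the shadow: for every class `k`, given H, A (+CT, split Tamagawa, defect 0),
V with road δ's `κ = −2`, and B: (i) the undescended exponent is even, (ii) `μ` is even, and (iii) with
`μ = 0` and `i_z ≥ i + 1` the stub's inequality follows. -/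
theorem parityDigit_decomposition (k : Fin 3) {X2 xW a s g τK δ τQ vf iz c i : ℤ} {μ : ℕ}
    (hH : ThetaEigenLogShape k X2 xW) (hA : AlgSpecShape a s g τK δ) (hCT : Even s) (hTam : τK = 2 * τQ)
    (hδ : δ = 0) (hV : ValShape vf g iz c (-2)) (hB : BranchEqModMu a vf μ) :
    Even (X2 - nExp k) ∧ Even (μ : ℤ) ∧ (μ = 0 → i + 1 ≤ iz → 2 * i - 2 * c ≤ s + τK) := by
  refine ⟨undescended_exponent_even k hH, roadDelta_mu_even hA hCT hTam hδ hV hB, fun hμ hiz => ?_⟩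
  subst hμ
  have hincl : vf - ((0 : ℕ) : ℤ) ≤ a := by unfold BranchEqModMu at hB; push_cast at hB ⊢; omega
  exact stub_of_transport hA hV hincl (by push_cast; omega)

end Summit.BirchSwinnertonDyer.BirchSwinnertonDyer.Cruxes.SplitBadTwoLowerHalfOfFacts.ParityDigitK3G49
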